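import Literature.Geometry.Kaehler.ComplexTorusHodgeGroupPiNonCMEllipticCurvesMultiplicitiesProduct
import HarnessLib

/-!
# Hazama's theorem (2) for `X₁ =` ANY finite product of elliptic curves without complex multiplication:
# `Hg(X₁ × ⋯ × X_K × Y) = Hg(X₁ × ⋯ × X_K) × Hg(Y)` for one-dimensional complex tori `X_k` with `End_ℚ(X_k) = ℚ`
# (isogenous or not, repeated or not) and ANY complex torus `Y` with commutative `Hg(Y)(ℂ)`; hence `P = P·P`, the
# `D = B` transfer, `Lf = Hg × Lf`, the Hazama–Murty transfer `Hg(Y) = Lf(Y) ⟺ Hg(X₁ × ⋯ × X_K × Y) = Lf`, and — for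
# `Y` on the Hodge-circle locus — `Hg = Lf` and `D = B` unconditionally (Moonen–Zarhin 1999 (0.2)(4), §1, §3; Imai 1976)

Layer `Literature/Geometry/Kaehler`, namespace `Literature.Geometry.Kaehler.ComplexTorus`; lane `lit-hodgefound`
(Track 2 foundations library), Layer A4 (Hodge groups of products, known cases); prover seat `lit-hodgefound-p17`
(generation 36, self-proposed row g36-#6 = «arbitrary» in place of g36-#5's «pairwise non-isogenous or equal»). Consumed
BY NAME, nothing restated: g36-#5 `ComplexTorusHodgeGroupPiNonCMEllipticCurvesMultiplicitiesProduct`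
(`hodgeGroup_pi_comp_prod_eq_map_prod_of_forall_endAlgRat_eq_bot`: the product formula for LITERAL repeats
`E_{c(1)} × ⋯ × E_{c(K)} × Y`), g36-#2 (`mem_hodgeGroup_pi_iff_of_forall_endAlgRat_eq_bot`: `Hg(∏_i E_i) = SL₂^r`),
p40 `ComplexTorusHodgeGroupHodgeCircleProductsSplit` (`IsIsogenous.hodgeGroup_prod_eq_map_blockDiag_iff`: ISOGENY
INVARIANCE OF THE SPLITTING; `homRat_eq_bot_of_hodgeGroup_prodPeriod_eq_map_blockDiag`), g36-#4
(`homRat_swap_eq_bot_of_hodgeGroup_prodPeriod_eq_map_blockDiag`), p22 `ComplexTorusHodgeGroupPiIsogenousFactors` §3 (the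
canonical twist data `isogenyClass`, `isogenyRep`, `isogenyTwist`, `isogenyTwistInv`, `twistDiagSL`;
`isIsogenous_isogenyRep_isogenyClass`, `not_isIsogenous_isogenyRep`, `mem_hodgeGroup_pi_iff_isogenyRep`),
`ComplexTorusFiniteProduct` (`IsIsogenous.pi`, `IsIsomorphic.pi`), `ComplexTorusPoincareCompleteReducibility`
(`isSimple_of_card_eq_two`, `IsSimple.homRat_eq_bot`), `ComplexTorusEllipticCurveIsomorphismClasses`
(`exists_isIsomorphic_ellipticPeriod`), `ComplexTorusIsogenies` (`IsIsogenous.isAbelianVariety_iff`),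
`ComplexTorusLefschetzGroupFiniteProduct` (Murty–Gordon `IsIsogenous.lefschetzGroup_eq_hodgeGroup_of_pi_ellipticPeriod`,
`IsRiemannForm.pi`, `isAbelianVariety_ellipticPeriod`), `ComplexTorusLefschetzGroupProduct`
(`IsRiemannForm.lefschetzGroup_prod_eq`, `blockDiag_mem_lefschetzGroup_prod`), p22 §10
(`IsRiemannForm.hodgeGroup_prod_eq_lefschetzGroup_of_eq`), g36-#2 / `ComplexTorusHodgeClassesProductHodgeGroup` §5
(`hodgePoincare_prod_eq_mul_of_prod_le_hodgeGroup`, `finrank_hodgeClasses_prod_eq_sum_of_prod_le_hodgeGroup`,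
`divisorClasses_prod_eq_hodgeClasses_of_prod_le_hodgeGroup`, `divisorClasses_pi_eq_hodgeClasses_of_rank_one`,
`divisorClasses_sigmaPiPeriod_eq_hodgeClasses_of_coe_eq_range`), g33 / g35-#2 (the locus). THEOREMS ONLY (no definition, no
instance, no notation, no named fact; D-0026 net debt 0).

## Sources, verbatim

* B. Moonen, Yu. G. Zarhin, Math. Ann. **315** (1999) (held `paper:arxiv-math_9901113`): (0.2)(4) and §1, p0002
  L138–L141 ("For `n ≥ 1` we can identify `Hg(Xⁿ)` with `Hg(X)` […] More generally, if `n₁, …, n_r ∈ ℤ_{≥1}` then we can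
  identify `Hg(X₁^{n₁} × ⋯ × X_r^{n_r})` with `Hg(X₁ × ⋯ × X_r)`"; `Hg` depends on `X` up to isogeny: "Decompose `X`, up
  to isogeny, as `X ∼ Y₁^{m₁} × ⋯ × Y_r^{m_r}`"); §1 p0004 L71–L78 (Hazama–Murty: "`Hg(X) = Sp_D(V, φ)` ⟺ (`X` has no
  factors of type III and `𝒟•(Xⁿ) = ℬ•(Xⁿ)` for all `n`)"); §3 Theorem (Hazama) (2), p0006 L74–L78: "Suppose `X₁` has
  no factors of Type IV and `X₂` is of CM-type. Then `X₁ × X₂` again satisfies (D) and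
  `Hg(X₁ × X₂) = Hg(X₁) × Hg(X₂)`."; §3 (1) p0006 L53–L57; (3.1); §3 Corollary, p0007 L80–L85: "In particular, every
  product of elliptic curves satisfies condition (D)".
* H. Imai, Kōdai Math. Sem. Rep. **27** (1976), §2 Proposition, third case (p. 370 L11–L15); §3 Remarks (p. 370
  L23–L38): "For the product of elliptic curves (isogenous or not), its Hodge group can be obtained as follows: […]
  `Hg(∏_{i,j} E_i^{(j)}) = ∏_i Δ_{m_i}(Hg(E_i))`".
* B. B. Gordon, *A survey of the Hodge conjecture for abelian varieties* (held `paper:arxiv-alg-geom_9709030`), §3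
  Theorem and proof (p0014 L25–L37), 2.15 Lemma (p0012 L77–L97), 7.5 Theorem (b) (p0020 L118–L123).
* J. S. Milne, *Lefschetz classes on abelian varieties*, Duke Math. J. **96** (1999), §1 pp. 642–643, §4 Prop. 4.8.
* H. Lange, *Abelian Varieties over the Complex Numbers* (2023), §7.2.4 Exercises (4), (5); §2.1.1 Prop. 2.1.1 (b),
  Example 2.1.3; §1.1.2 Cor. 1.1.16.

## What is proved (`X_k = ℂ/X_k(ℤ²)` one-dimensional with `End_ℚ(X_k) = ℚ`, `k < K`, NO further hypothesis;
`Y = E₂/Φ₂(ℤ^{ι₂})` with commutative `Hg(Y)(ℂ)`; `A = X₁ × ⋯ × X_K × Y`)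

* §1 One-dimensional tori: they are abelian varieties (`isAbelianVariety_of_dimOne`, `isAbelianVariety_pi_of_dimOne`),
  non-isogenous ones are `Hom_ℚ`-orthogonal (`homRat_eq_bot_of_not_isIsogenous_of_dimOne`); the canonical isogeny
  `∏_k X_{s(c(k))} ∼ ∏_k X_k` to the literal-repeats family of representatives (`isIsogenous_pi_isogenyRep_comp`, any
  homogeneous family) and the `Hom_ℚ`-orthogonality of the representatives (`homRat_isogenyRep_eq_bot_of_ne`);
  **`Lf(X₁ × ⋯ × X_K) = Hg(X₁ × ⋯ × X_K)` for EVERY family of one-dimensional tori and every polarisation**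
  (`IsRiemannForm.lefschetzGroup_pi_eq_hodgeGroup_of_dimOne`; Murty–Gordon through `∏_k X_k ≅ ∏_k E_{τ_k}`).
* §2 **THE PRODUCT FORMULA `Hg(X₁ × ⋯ × X_K × Y) = Hg(X₁ × ⋯ × X_K) × Hg(Y)`** for ANY non-CM one-dimensional `X_k` and
  commutative `Hg(Y)(ℂ)` (`hodgeGroup_pi_prod_eq_map_prod_of_forall_endAlgRat_eq_bot_of_comm`): g36-#5's literal-repeats
  formula for `∏_k X_{s(c(k))} × Y` transported along `∏_k X_{s(c(k))} ∼ ∏_k X_k`, `Y ∼ Y` by the isogeny invariance of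
  the splitting; `Hom_ℚ(∏X_k, Y) = 0 = Hom_ℚ(Y, ∏X_k)`; the explicit form
  `M ∈ Hg(A)(ℝ) ⟺ M = (δ_{c,P,Q}(A) 0; 0 N)`, `A ∈ SL₂(ℝ)^r`, `N ∈ Hg(Y)(ℝ)` (`mem_hodgeGroup_pi_prod_iff_isogenyRep_of_comm`).
* §3 **`P_A = P_{∏X_k} · P_Y`**, the Künneth count, **the `D = B` transfer** (`Dᵇ = H^{2b}_Hodge` on `Y` ⟹ on `A`).
* §4 **THE LEFSCHETZ PRODUCT FORMULA `Lf(A, η) = Hg(∏X_k) × Lf(Y, ω₂)`**, **THE TRANSFER `Hg(Y) = Lf(Y) ⟹ Hg(A) = Lf(A, η)`**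
  and **THE CRITERION `Hg(A) = Lf(A, η) ⟺ Hg(Y) = Lf(Y, η₂)`**, all polarisations.
* §5 The `E_τ` wording with the ONLY hypothesis `End(E_{τ_k}) = ℤ` (`hodgeGroup_pi_ellipticPeriod_prod_eq_map_prod_of_forall_ellipticEnd_eq_bot`,
  `divisorClasses_pi_ellipticPeriod_prod_eq_hodgeClasses_of_forall_ellipticEnd_eq_bot`,
  `IsRiemannForm.hodgeGroup_pi_ellipticPeriod_prod_eq_lefschetzGroup_iff_of_forall_ellipticEnd_eq_bot`), and **THE LOCUS,
  UNCONDITIONALLY: `Hg = Lf` (every polarisation) and `D = B` (every codimension) on `X₁ × ⋯ × X_K × ∏ₗ Z_l`** for any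
  non-CM one-dimensional `X_k` and any positive-dimensional tori `Z_l` on the Hodge-circle locus (which include all CM
  elliptic curves and their products) — "every product of elliptic curves satisfies condition (D)", group half and
  `D = B`, at torus level, with CM blocks of any dimension.

Faithfulness notes. (i) Moonen–Zarhin's Theorem (2) allows any `X₁` without type-IV factors; formalised is `X₁ =` a
product of non-CM elliptic curves (no type III/IV factors) and `X₂ = Y` with commutative `Hg(Y)(ℂ)` (their "CM-type",
for abelian varieties). (ii) "Condition (D)" comprises `Hg = Sp_D` AND `𝒟•(Xⁿ) = ℬ•(Xⁿ)` for all powers; proved here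
are `Hg = Lf` and `D = B` for the product itself (all codimensions); powers of `A` are again of the form treated here
only up to the isomorphism `Aⁿ ≅ (∏X_k)ⁿ × Yⁿ`, which is not spelled out. -- TODO(general form): powers `Aⁿ`.

## References

* [MoonenZarhin1999LowDim] B. Moonen, Yu. G. Zarhin, Math. Ann. 315 (1999), (0.2)(4), §1, §3 Theorem (2), §3 (1), (3.1), §3 Corollary.
* [Imai1976HodgeGroups] H. Imai, Kōdai Math. Sem. Rep. 27 (1976), §2 Proposition (third case), §3 Remarks (p. 370).
* [Gordon1997] B. B. Gordon (1999), §3 Theorem and its proof, 2.15 Lemma, 7.5 Theorem (b).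
* [Milne1999LefschetzClasses] J. S. Milne, Duke Math. J. 96 (1999), §1, §4 Prop. 4.8.
* [Lange2023AbelianVarietiesComplex] H. Lange (2023), §7.2.4 Exercises (4), (5), §2.1.1, §1.1.2 Cor. 1.1.16.
* [vanGeemen1994HodgeAV] B. van Geemen (1994), 3.6 and §4 Thm. 4.3 (Tate).
-/

noncomputable section

open scoped Real MatrixGroups
open Complex Module Matrix Function
open Finset.HasAntidiagonal (antidiagonal)

namespace Literature.Geometry.Kaehler

namespace ComplexTorus

/-! ## §1 One-dimensional tori; the canonical isogeny to the family of representatives; `Lf(∏X_k) = Hg(∏X_k)` -/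

section DimOne

variable {K : ℕ}

/-- **Every one-dimensional complex torus is an abelian variety** (`X ≅ E_τ`, and `E_τ` is polarised).
[cite: Lange2023AbelianVarietiesComplex, §2.1.1 Example 2.1.3 and Prop. 2.1.1 (b)] -/
theorem isAbelianVariety_of_dimOne (Φ₀ : (Fin 2 → ℝ) ≃L[ℝ] ℂ) : IsAbelianVariety Φ₀ := by
  obtain ⟨τ, hτ, hiso⟩ := exists_isIsomorphic_ellipticPeriod Φ₀ (Module.finrank_self ℂ)
  exact (hiso.isIsogenous.isAbelianVariety_iff _ _).2 (isAbelianVariety_ellipticPeriod hτ)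

/-- **A finite product of one-dimensional complex tori is an abelian variety** (`∏_k X_k ≅ ∏_k E_{τ_k}`, polarised by
`⊞_k ω_k`). [cite: Lange2023AbelianVarietiesComplex, §2.1.1 Example 2.1.3 and §2.4.4 Cor. 2.4.24] -/
theorem isAbelianVariety_pi_of_dimOne (X : Fin K → ((Fin 2 → ℝ) ≃L[ℝ] ℂ)) : IsAbelianVariety (piPeriod X) := by
  choose τ hτ hiso using fun k ↦ exists_isIsomorphic_ellipticPeriod (X k) (Module.finrank_self ℂ)
  choose ω hω using fun k ↦ isAbelianVariety_ellipticPeriod (hτ k)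
  exact ((IsIsomorphic.pi hiso).isIsogenous.isAbelianVariety_iff _ _).2 ⟨_, IsRiemannForm.pi hω⟩

/-- **Non-isogenous one-dimensional tori are `Hom_ℚ`-orthogonal** (they are simple).
[cite: Lange2023AbelianVarietiesComplex, §1.1.2 Cor. 1.1.16 and §2.4.4 Cor. 2.4.26 (proof)] -/
theorem homRat_eq_bot_of_not_isIsogenous_of_dimOne {Φ₀ Φ₁ : (Fin 2 → ℝ) ≃L[ℝ] ℂ} (h : ¬ IsIsogenous Φ₀ Φ₁) :
    homRat Φ₀ Φ₁ = ⊥ :=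
  (isSimple_of_card_eq_two _ (Fintype.card_fin 2)).homRat_eq_bot (isSimple_of_card_eq_two _ (Fintype.card_fin 2)) h

/-- **The canonical isogeny `∏_k X_{s(c(k))} ∼ ∏_k X_k`** from the LITERAL-repeats family of the representatives
`X_{s(i)}` of the isogeny classes of the factors (any homogeneous family of tori) — "Decompose `X`, up to isogeny, as
`X ∼ Y₁^{m₁} × ⋯ × Y_r^{m_r}`". [cite: MoonenZarhin1999LowDim, (0.2)(4) (p0002 L1–L3) and §1 (p0002 L138–L141)]
[cite: Imai1976HodgeGroups, §3 Remarks (p. 370 L31–L38)] -/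
theorem isIsogenous_pi_isogenyRep_comp {ι : Type*} [Fintype ι] [DecidableEq ι] {E : Type*} [NormedAddCommGroup E]
    [NormedSpace ℂ E] (Θ : Fin K → ((ι → ℝ) ≃L[ℝ] E)) :
    IsIsogenous (piPeriod fun k ↦ Θ (isogenyRep Θ (isogenyClass Θ k))) (piPeriod Θ) :=
  IsIsogenous.pi fun k ↦ isIsogenous_isogenyRep_isogenyClass Θ k

/-- The representatives of the isogeny classes of a family of one-dimensional tori are pairwise `Hom_ℚ`-orthogonal.
[cite: Imai1976HodgeGroups, §3 Remarks (p. 370: "`E_i`, `E_{i'}` (`i ≠ i'`) are non-isogenous")] [cite: Lange2023AbelianVarietiesComplex, §2.4.4 Cor. 2.4.26 (proof)] -/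
theorem homRat_isogenyRep_eq_bot_of_ne (X : Fin K → ((Fin 2 → ℝ) ≃L[ℝ] ℂ)) {i j : Fin (numIsogenyClasses X)}
    (hij : i ≠ j) : homRat (X (isogenyRep X i)) (X (isogenyRep X j)) = ⊥ :=
  homRat_eq_bot_of_not_isIsogenous_of_dimOne (not_isIsogenous_isogenyRep X hij)

/-- The class map `c` of a family is onto (`c (s i) = i`). [cite: MoonenZarhin1999LowDim, (0.2)(4)] -/
theorem isogenyClass_surjective {ι : Type*} [Fintype ι] [DecidableEq ι] {E : Type*} [NormedAddCommGroup E]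
    [NormedSpace ℂ E] (Θ : Fin K → ((ι → ℝ) ≃L[ℝ] E)) : Function.Surjective (isogenyClass Θ) :=
  fun i ↦ ⟨isogenyRep Θ i, isogenyClass_isogenyRep Θ i⟩

/-- **`Lf(X₁ × ⋯ × X_K)(ℝ) = Hg(X₁ × ⋯ × X_K)(ℝ)` for EVERY finite family of one-dimensional complex tori and every
polarisation `η`** (with or without complex multiplication, isogenous or not): `∏_k X_k ≅ ∏_k E_{τ_k}` and the tree's
Murty–Gordon theorem `IsIsogenous.lefschetzGroup_eq_hodgeGroup_of_pi_ellipticPeriod` — "(b) `Hg(A) = Lf(A)`" for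
everything isogenous to a product of elliptic curves. [cite: Gordon1997, 7.5 Theorem (b) and §3 ("for arbitrary products of elliptic curves")]
[cite: MoonenZarhin1999LowDim, §3 Corollary (p0007 L80–L85)] [cite: Lange2023AbelianVarietiesComplex, §7.2.4 Exercises (4), (5)] -/
theorem IsRiemannForm.lefschetzGroup_pi_eq_hodgeGroup_of_dimOne (X : Fin K → ((Fin 2 → ℝ) ≃L[ℝ] ℂ))
    {η : (Fin K → ℂ) [⋀^Fin 2]→L[ℝ] ℝ} (hη : IsRiemannForm (piPeriod X) η) :
    lefschetzGroup (piPeriod X) η = hodgeGroup (piPeriod X) := by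
  choose τ hτ hiso using fun k ↦ exists_isIsomorphic_ellipticPeriod (X k) (Module.finrank_self ℂ)
  exact ((IsIsomorphic.pi hiso).isIsogenous.symm _ _).lefschetzGroup_eq_hodgeGroup_of_pi_ellipticPeriod hτ hη

end DimOne

/-! ## §2 The product formula `Hg(X₁ × ⋯ × X_K × Y) = Hg(X₁ × ⋯ × X_K) × Hg(Y)` for arbitrary non-CM curves -/

section ProductFormula

variable {K : ℕ} (X : Fin K → ((Fin 2 → ℝ) ≃L[ℝ] ℂ)) {ι₂ : Type*} [Fintype ι₂] [DecidableEq ι₂]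
  {E₂ : Type*} [NormedAddCommGroup E₂] [NormedSpace ℂ E₂] (Φ₂ : (ι₂ → ℝ) ≃L[ℝ] E₂)
  (hX : ∀ k, endAlgRat (X k) = ⊥)
  (hcomm : ∀ M N : SpecialLinearGroup ι₂ ℂ, M ∈ hodgeGroupC Φ₂ → N ∈ hodgeGroupC Φ₂ → M.1 * N.1 = N.1 * M.1)

include hX hcomm in
/-- **HAZAMA'S THEOREM (2) FOR `X₁ =` ANY PRODUCT OF ELLIPTIC CURVES WITHOUT COMPLEX MULTIPLICATION:
`Hg(X₁ × ⋯ × X_K × Y)(ℝ) = Hg(X₁ × ⋯ × X_K)(ℝ) × Hg(Y)(ℝ)`** (block-diagonally), for one-dimensional complex tori `X_k`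
with `End_ℚ(X_k) = ℚ` — isogenous or not, repeated or not — and ANY complex torus `Y` with commutative `Hg(Y)(ℂ)`:
g36-#5's formula for the literal-repeats family `∏_k X_{s(c(k))} × Y` of the representatives of the isogeny classes
(pairwise non-isogenous, hence `Hom_ℚ`-orthogonal), transported along `∏_k X_{s(c(k))} ∼ ∏_k X_k` and `Y ∼ Y` by the
isogeny invariance of the splitting — "Suppose `X₁` has no factors of Type IV and `X₂` is of CM-type. Then […]
`Hg(X₁ × X₂) = Hg(X₁) × Hg(X₂)`" with "Decompose `X`, up to isogeny, as `X ∼ Y₁^{m₁} × ⋯ × Y_r^{m_r}`".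
[cite: MoonenZarhin1999LowDim, §3 Theorem (2) (p0006 L74–L78), (0.2)(4) and §1 (p0002 L138–L141)]
[cite: Imai1976HodgeGroups, §2 Proposition, third case (p. 370 L11–L15) and §3 Remarks (p. 370 L23–L38)]
[cite: Gordon1997, §3 Theorem, proof (p0014 L33–L37)] -/
theorem hodgeGroup_pi_prod_eq_map_prod_of_forall_endAlgRat_eq_bot_of_comm :
    hodgeGroup (prodPeriod (piPeriod X) Φ₂) =
      ((hodgeGroup (piPeriod X)).prod (hodgeGroup Φ₂)).map (blockDiag (Fin K × Fin 2) ι₂) :=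
  ((isIsogenous_pi_isogenyRep_comp X).hodgeGroup_prod_eq_map_blockDiag_iff (IsIsogenous.refl (Φ := Φ₂))).1
    (hodgeGroup_pi_comp_prod_eq_map_prod_of_forall_endAlgRat_eq_bot (fun i ↦ X (isogenyRep X i)) (isogenyClass X) Φ₂
      (fun _ ↦ hX _) (fun _ _ hij ↦ homRat_isogenyRep_eq_bot_of_ne X hij) (isogenyClass_surjective X) hcomm)

include hX hcomm in
/-- `Hg(∏_k X_k)(ℝ) × Hg(Y)(ℝ) ≤ Hg((∏_k X_k) × Y)(ℝ)` — the hypothesis of the tree's Künneth theorems.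
[cite: MoonenZarhin1999LowDim, §3 Theorem (2) and (3.1)] -/
theorem prod_map_blockDiag_le_hodgeGroup_pi_prod_of_comm :
    ((hodgeGroup (piPeriod X)).prod (hodgeGroup Φ₂)).map (blockDiag (Fin K × Fin 2) ι₂) ≤
      hodgeGroup (prodPeriod (piPeriod X) Φ₂) :=
  (hodgeGroup_pi_prod_eq_map_prod_of_forall_endAlgRat_eq_bot_of_comm X Φ₂ hX hcomm).ge

include hX hcomm in
/-- **`Hom_ℚ(X₁ × ⋯ × X_K, Y) = 0`**: a torus with commutative `Hg(ℂ)` receives no non-zero homomorphism from a product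
of non-CM curves. [cite: MoonenZarhin1999LowDim, §3 Theorem (2) and §3 (1) (p0006 L53–L57)] [cite: Imai1976HodgeGroups, §3 Remarks (p. 370)] -/
theorem homRat_pi_eq_bot_of_forall_endAlgRat_eq_bot_of_comm : homRat (piPeriod X) Φ₂ = ⊥ :=
  homRat_eq_bot_of_hodgeGroup_prodPeriod_eq_map_blockDiag _ Φ₂
    (hodgeGroup_pi_prod_eq_map_prod_of_forall_endAlgRat_eq_bot_of_comm X Φ₂ hX hcomm)

include hX hcomm in
/-- **`Hom_ℚ(Y, X₁ × ⋯ × X_K) = 0`** likewise. [cite: MoonenZarhin1999LowDim, §3 Theorem (2) and §3 (1) (p0006 L53–L57)]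
[cite: Imai1976HodgeGroups, §3 Remarks (p. 370)] -/
theorem homRat_pi_swap_eq_bot_of_forall_endAlgRat_eq_bot_of_comm : homRat Φ₂ (piPeriod X) = ⊥ :=
  homRat_swap_eq_bot_of_hodgeGroup_prodPeriod_eq_map_blockDiag _ Φ₂
    (hodgeGroup_pi_prod_eq_map_prod_of_forall_endAlgRat_eq_bot_of_comm X Φ₂ hX hcomm)

include hX in
/-- **`Hg(X₁ × ⋯ × X_K)(ℝ) = δ_{c,P,Q}(SL₂(ℝ)^r)` on elements** for non-CM one-dimensional tori: the tree's canonical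
form `mem_hodgeGroup_pi_iff_isogenyRep` (twisted diagonal over the representatives) with `Hg(∏_i X_{s(i)}) = SL₂^r`
(Imai's Proposition, second case, for the pairwise non-isogenous representatives) — Imai's §3 Remarks
"`Hg(∏_{i,j} E_i^{(j)}) = ∏_i Δ_{m_i}(Hg(E_i))`" for curves without complex multiplication, abstract tori.
[cite: Imai1976HodgeGroups, §3 Remarks (p. 370 L23–L38) and §2 Proposition (p. 368 L11–L13)] [cite: MoonenZarhin1999LowDim, (0.2)(4) and §1] -/
theorem mem_hodgeGroup_pi_iff_isogenyRep_of_forall_endAlgRat_eq_bot {M : SpecialLinearGroup (Fin K × Fin 2) ℝ} :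
    M ∈ hodgeGroup (piPeriod X) ↔ ∃ A : Fin (numIsogenyClasses X) → SL(2, ℝ),
      M = twistDiagSL (isogenyClass X) (isogenyTwist X) (isogenyTwistInv X) (isogenyTwist_mul_isogenyTwistInv X) A := by
  rw [mem_hodgeGroup_pi_iff_isogenyRep X]
  refine exists_congr fun A ↦ and_iff_right ?_
  exact (mem_hodgeGroup_pi_iff_of_forall_endAlgRat_eq_bot _ (fun _ ↦ hX _)
    (fun _ _ hij ↦ homRat_isogenyRep_eq_bot_of_ne X hij)).2 ⟨A, rfl⟩

include hX hcomm in
/-- **On elements: `M ∈ Hg(X₁ × ⋯ × X_K × Y)(ℝ) ⟺ M = (δ_{c,P,Q}(A) 0; 0 N)` with `A ∈ SL₂(ℝ)^r` ARBITRARY and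
`N ∈ Hg(Y)(ℝ)`** (`r` = number of isogeny classes among the `X_k`, `δ` the tree's canonical twisted diagonal).
[cite: MoonenZarhin1999LowDim, §3 Theorem (2), (0.2)(4) and §1] [cite: Imai1976HodgeGroups, §3 Remarks (p. 370 L23–L38)] -/
theorem mem_hodgeGroup_pi_prod_iff_isogenyRep_of_comm {M : SpecialLinearGroup ((Fin K × Fin 2) ⊕ ι₂) ℝ} :
    M ∈ hodgeGroup (prodPeriod (piPeriod X) Φ₂) ↔
      ∃ (A : Fin (numIsogenyClasses X) → SL(2, ℝ)) (N : SpecialLinearGroup ι₂ ℝ), N ∈ hodgeGroup Φ₂ ∧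
        M = blockDiag (Fin K × Fin 2) ι₂
          (twistDiagSL (isogenyClass X) (isogenyTwist X) (isogenyTwistInv X) (isogenyTwist_mul_isogenyTwistInv X) A, N) := by
  rw [hodgeGroup_pi_prod_eq_map_prod_of_forall_endAlgRat_eq_bot_of_comm X Φ₂ hX hcomm, Subgroup.mem_map]
  constructor
  · rintro ⟨⟨P, N⟩, hPN, rfl⟩
    obtain ⟨hP, hN⟩ := Subgroup.mem_prod.1 hPN
    obtain ⟨A, rfl⟩ := (mem_hodgeGroup_pi_iff_isogenyRep_of_forall_endAlgRat_eq_bot X hX).1 hP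
    exact ⟨A, N, hN, rfl⟩
  · rintro ⟨A, N, hN, rfl⟩
    exact ⟨(_, N), Subgroup.mem_prod.2
      ⟨(mem_hodgeGroup_pi_iff_isogenyRep_of_forall_endAlgRat_eq_bot X hX).2 ⟨A, rfl⟩, hN⟩, rfl⟩

/-! ## §3 The Hodge classes: `P_A = P_{∏X_k} · P_Y`, the `D = B` transfer -/

include hX hcomm in
/-- **`P_{(∏_k X_k) × Y}(t) = P_{∏_k X_k}(t) · P_Y(t)`** (graded dimensions of the Hodge classes).
[cite: Gordon1997, §3 Theorem (second bullet) and its proof (p0014 L25–L33)] [cite: MoonenZarhin1999LowDim, §3 (3.1)] -/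
theorem hodgePoincare_pi_prod_eq_mul_of_forall_endAlgRat_eq_bot_of_comm :
    hodgePoincare (prodPeriod (piPeriod X) Φ₂) = hodgePoincare (piPeriod X) * hodgePoincare Φ₂ :=
  hodgePoincare_prod_eq_mul_of_prod_le_hodgeGroup _ Φ₂ (prod_map_blockDiag_le_hodgeGroup_pi_prod_of_comm X Φ₂ hX hcomm)

include hX hcomm in
/-- **The Künneth count `dim_ℚ H^{2p}_Hodge((∏_k X_k) × Y) = Σ_{a+b=p} dim_ℚ H^{2a}_Hodge(∏_k X_k) · dim_ℚ H^{2b}_Hodge(Y)`.**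
[cite: Gordon1997, §3 Theorem, proof (p0014 L25–L33)] [cite: MoonenZarhin1999LowDim, §3 (3.1)] -/
theorem finrank_hodgeClasses_pi_prod_eq_sum_of_forall_endAlgRat_eq_bot_of_comm (p : ℕ) :
    finrank ℚ (hodgeClasses (prodPeriod (piPeriod X) Φ₂) p) =
      ∑ ab ∈ antidiagonal p, finrank ℚ (hodgeClasses (piPeriod X) ab.1) * finrank ℚ (hodgeClasses Φ₂ ab.2) :=
  finrank_hodgeClasses_prod_eq_sum_of_prod_le_hodgeGroup _ Φ₂
    (prod_map_blockDiag_le_hodgeGroup_pi_prod_of_comm X Φ₂ hX hcomm) p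

include hX hcomm in
/-- **THE `D = B` TRANSFER: `Dᵇ = H^{2b}_Hodge` on `Y` for `b ≤ p` ⟹ `Dᵖ(X₁ × ⋯ × X_K × Y) = H^{2p}_Hodge`** ("`X₁ × X₂` again
satisfies (D)"; `D = B` on `∏_k X_k` is Tate's theorem `divisorClasses_pi_eq_hodgeClasses_of_rank_one`).
[cite: MoonenZarhin1999LowDim, §3 Theorem (2) (p0006 L74–L78) and (3.1)] [cite: Gordon1997, §3 Theorem (second bullet)]
[cite: vanGeemen1994HodgeAV, §4 Thm. 4.3 (Tate)] -/
theorem divisorClasses_pi_prod_eq_hodgeClasses_of_forall_endAlgRat_eq_bot_of_comm {p : ℕ}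
    (hY : ∀ b ≤ p, divisorClasses Φ₂ b = hodgeClasses Φ₂ b) :
    divisorClasses (prodPeriod (piPeriod X) Φ₂) p = hodgeClasses (prodPeriod (piPeriod X) Φ₂) p :=
  divisorClasses_prod_eq_hodgeClasses_of_prod_le_hodgeGroup _ Φ₂
    (prod_map_blockDiag_le_hodgeGroup_pi_prod_of_comm X Φ₂ hX hcomm)
    (fun a _ ↦ divisorClasses_pi_eq_hodgeClasses_of_rank_one _ a) hY

include hX hcomm in
/-- All codimensions: **`D = B` on `Y` ⟹ `D = B` on `X₁ × ⋯ × X_K × Y`.** [cite: MoonenZarhin1999LowDim, §3 Theorem (2) and (3.1)]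
[cite: Gordon1997, §3 Theorem (second bullet)] -/
theorem forall_divisorClasses_pi_prod_eq_hodgeClasses_of_forall_endAlgRat_eq_bot_of_comm
    (hY : ∀ b, divisorClasses Φ₂ b = hodgeClasses Φ₂ b) (p : ℕ) :
    divisorClasses (prodPeriod (piPeriod X) Φ₂) p = hodgeClasses (prodPeriod (piPeriod X) Φ₂) p :=
  divisorClasses_pi_prod_eq_hodgeClasses_of_forall_endAlgRat_eq_bot_of_comm X Φ₂ hX hcomm fun b _ ↦ hY b

end ProductFormula

/-! ## §4 Hodge = Lefschetz: the Lefschetz product formula, the transfer, the criterion -/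

section Lefschetz

variable {K : ℕ} (X : Fin K → ((Fin 2 → ℝ) ≃L[ℝ] ℂ)) {ι₂ : Type*} [Fintype ι₂] [DecidableEq ι₂]
  {E₂ : Type*} [NormedAddCommGroup E₂] [NormedSpace ℂ E₂] [FiniteDimensional ℂ E₂] (Φ₂ : (ι₂ → ℝ) ≃L[ℝ] E₂)
  (hX : ∀ k, endAlgRat (X k) = ⊥)
  (hcomm : ∀ M N : SpecialLinearGroup ι₂ ℂ, M ∈ hodgeGroupC Φ₂ → N ∈ hodgeGroupC Φ₂ → M.1 * N.1 = N.1 * M.1)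

include hX hcomm in
/-- **THE LEFSCHETZ PRODUCT FORMULA `Lf(X₁ × ⋯ × X_K × Y, η) = Hg(X₁ × ⋯ × X_K) × Lf(Y, ω₂)`** for every polarisation `η`
of the product (Lemma 2.15 with `Hom_ℚ = 0` both ways, and `Lf(∏X_k) = Hg(∏X_k)`).
[cite: Gordon1997, 2.15 Lemma (p0012 L77–L97) and 7.5 Theorem (b)] [cite: Lange2023AbelianVarietiesComplex, §7.2.4 Exercise (4)(a), (c)]
[cite: Milne1999LefschetzClasses, §1 (pp. 642–643)] -/
theorem IsRiemannForm.lefschetzGroup_pi_prod_eq_of_forall_endAlgRat_eq_bot_of_comm {ω₂ : E₂ [⋀^Fin 2]→L[ℝ] ℝ}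
    (h₂ : IsRiemannForm Φ₂ ω₂) {η : ((Fin K → ℂ) × E₂) [⋀^Fin 2]→L[ℝ] ℝ} (hη : IsRiemannForm (prodPeriod (piPeriod X) Φ₂) η) :
    lefschetzGroup (prodPeriod (piPeriod X) Φ₂) η =
      ((hodgeGroup (piPeriod X)).prod (lefschetzGroup Φ₂ ω₂)).map (blockDiag (Fin K × Fin 2) ι₂) := by
  obtain ⟨ω₁, h₁⟩ := isAbelianVariety_pi_of_dimOne X
  rw [hη.lefschetzGroup_eq (h₁.prod h₂),
    h₁.lefschetzGroup_prod_eq h₂ (homRat_pi_eq_bot_of_forall_endAlgRat_eq_bot_of_comm X Φ₂ hX hcomm)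
      (homRat_pi_swap_eq_bot_of_forall_endAlgRat_eq_bot_of_comm X Φ₂ hX hcomm),
    h₁.lefschetzGroup_pi_eq_hodgeGroup_of_dimOne X]

include hX hcomm in
/-- **THE TRANSFER: `Hg(Y) = Lf(Y) ⟹ Hg(X₁ × ⋯ × X_K × Y) = Lf(X₁ × ⋯ × X_K × Y, η)` for every polarisation `η`** —
"`X₁ × X₂` again satisfies (D)" in the Hazama–Murty form "`Hg = Sp_D(V, φ)`" (group half, real points), `X₁ =` any
product of non-CM elliptic curves. [cite: MoonenZarhin1999LowDim, §3 Theorem (2) (p0006 L74–L78) with §1 (p0004 L71–L78)]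
[cite: Gordon1997, 7.5 Theorem (b) and 2.15 Lemma] [cite: Milne1999LefschetzClasses, §4 Prop. 4.8] -/
theorem IsRiemannForm.hodgeGroup_pi_prod_eq_lefschetzGroup_of_forall_endAlgRat_eq_bot_of_comm {ω₂ : E₂ [⋀^Fin 2]→L[ℝ] ℝ}
    (h₂ : IsRiemannForm Φ₂ ω₂) (hL : hodgeGroup Φ₂ = lefschetzGroup Φ₂ ω₂) {η : ((Fin K → ℂ) × E₂) [⋀^Fin 2]→L[ℝ] ℝ}
    (hη : IsRiemannForm (prodPeriod (piPeriod X) Φ₂) η) :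
    hodgeGroup (prodPeriod (piPeriod X) Φ₂) = lefschetzGroup (prodPeriod (piPeriod X) Φ₂) η := by
  obtain ⟨ω₁, h₁⟩ := isAbelianVariety_pi_of_dimOne X
  exact h₁.hodgeGroup_prod_eq_lefschetzGroup_of_eq h₂
    (hodgeGroup_pi_prod_eq_map_prod_of_forall_endAlgRat_eq_bot_of_comm X Φ₂ hX hcomm)
    (h₁.lefschetzGroup_pi_eq_hodgeGroup_of_dimOne X).symm hL hη

include hX hcomm in
/-- **THE CRITERION: `Hg(X₁ × ⋯ × X_K × Y) = Lf(X₁ × ⋯ × X_K × Y, η) ⟺ Hg(Y) = Lf(Y, η₂)`** for all polarisations `η`, `η₂`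
((⇒) `N ∈ Lf(Y)` gives `(1 0; 0 N) ∈ Hg(∏X) × Lf(Y) = Lf = Hg ⊆ Hg(∏X) × Hg(Y)`).
[cite: MoonenZarhin1999LowDim, §3 Theorem (2) with §1 (condition (D))] [cite: Gordon1997, 2.15 Lemma and 7.5 Theorem (b)]
[cite: Lange2023AbelianVarietiesComplex, §7.2.4 Exercises (4)(a), (c), (5)] -/
theorem IsRiemannForm.hodgeGroup_pi_prod_eq_lefschetzGroup_iff_of_forall_endAlgRat_eq_bot_of_comm
    {ω₂ : E₂ [⋀^Fin 2]→L[ℝ] ℝ} (h₂ : IsRiemannForm Φ₂ ω₂) {η : ((Fin K → ℂ) × E₂) [⋀^Fin 2]→L[ℝ] ℝ}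
    (hη : IsRiemannForm (prodPeriod (piPeriod X) Φ₂) η) {η₂ : E₂ [⋀^Fin 2]→L[ℝ] ℝ} (hη₂ : IsRiemannForm Φ₂ η₂) :
    hodgeGroup (prodPeriod (piPeriod X) Φ₂) = lefschetzGroup (prodPeriod (piPeriod X) Φ₂) η ↔
      hodgeGroup Φ₂ = lefschetzGroup Φ₂ η₂ := by
  obtain ⟨ω₁, h₁⟩ := isAbelianVariety_pi_of_dimOne X
  rw [hη₂.lefschetzGroup_eq h₂]
  refine ⟨fun h ↦ le_antisymm h₂.hodgeGroup_le_lefschetzGroup fun N hN ↦ ?_, fun hL ↦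
    IsRiemannForm.hodgeGroup_pi_prod_eq_lefschetzGroup_of_forall_endAlgRat_eq_bot_of_comm X Φ₂ hX hcomm h₂ hL hη⟩
  have hmem : blockDiag (Fin K × Fin 2) ι₂ (1, N) ∈ lefschetzGroup (prodPeriod (piPeriod X) Φ₂) η := by
    rw [hη.lefschetzGroup_eq (h₁.prod h₂)]
    exact blockDiag_mem_lefschetzGroup_prod (homRat_pi_eq_bot_of_forall_endAlgRat_eq_bot_of_comm X Φ₂ hX hcomm)
      (homRat_pi_swap_eq_bot_of_forall_endAlgRat_eq_bot_of_comm X Φ₂ hX hcomm) (one_mem _) hN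
  rw [← h] at hmem
  obtain ⟨⟨A, D⟩, hAD, hEq⟩ := Subgroup.mem_map.1 (hodgeGroup_prod_le _ _ hmem)
  have hDN : D = N := congrArg Prod.snd (blockDiag_injective _ _ hEq)
  rw [← hDN]
  exact (Subgroup.mem_prod.1 hAD).2

omit [DecidableEq ι₂] [FiniteDimensional ℂ E₂] in
/-- **`X₁ × ⋯ × X_K × Y` is an abelian variety** for one-dimensional `X_k` and polarised `Y`.
[cite: Lange2023AbelianVarietiesComplex, §2.4.4 Cor. 2.4.24 and §2.1.1 Example 2.1.3] -/
theorem isAbelianVariety_pi_prod_of_dimOne {ω₂ : E₂ [⋀^Fin 2]→L[ℝ] ℝ} (h₂ : IsRiemannForm Φ₂ ω₂) :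
    IsAbelianVariety (prodPeriod (piPeriod X) Φ₂) := by
  obtain ⟨ω₁, h₁⟩ := isAbelianVariety_pi_of_dimOne X
  exact ⟨_, h₁.prod h₂⟩

end Lefschetz

/-! ## §5 Elliptic curves `E_{τ_k}` with the only hypothesis `End(E_{τ_k}) = ℤ`; the locus `Y = ∏ₗ Z_l` -/

section Elliptic

variable {K : ℕ} {τ : Fin K → ℂ} (hτ : ∀ k, (τ k).im ≠ 0) {ι₂ : Type*} [Fintype ι₂] [DecidableEq ι₂]
  {E₂ : Type*} [NormedAddCommGroup E₂] [NormedSpace ℂ E₂] (Φ₂ : (ι₂ → ℝ) ≃L[ℝ] E₂)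
  (hEnd : ∀ k, ellipticEnd (hτ k) = ⊥)
  (hcomm : ∀ M N : SpecialLinearGroup ι₂ ℂ, M ∈ hodgeGroupC Φ₂ → N ∈ hodgeGroupC Φ₂ → M.1 * N.1 = N.1 * M.1)

include hEnd hcomm in
/-- **`Hg(E_{τ_1} × ⋯ × E_{τ_K} × Y) = Hg(E_{τ_1} × ⋯ × E_{τ_K}) × Hg(Y)`** for ANY elliptic curves with `End(E_{τ_k}) = ℤ`
(isogenous or not) and any torus `Y` with commutative `Hg(Y)(ℂ)` (real points, block-diagonally).
[cite: MoonenZarhin1999LowDim, §3 Theorem (2) (p0006 L74–L78), (0.2)(4) and §1] [cite: Imai1976HodgeGroups, §2 Proposition, third case, and §3 Remarks (p. 370)] -/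
theorem hodgeGroup_pi_ellipticPeriod_prod_eq_map_prod_of_forall_ellipticEnd_eq_bot :
    hodgeGroup (prodPeriod (piPeriod fun k ↦ ellipticPeriod (hτ k)) Φ₂) =
      ((hodgeGroup (piPeriod fun k ↦ ellipticPeriod (hτ k))).prod (hodgeGroup Φ₂)).map (blockDiag (Fin K × Fin 2) ι₂) :=
  hodgeGroup_pi_prod_eq_map_prod_of_forall_endAlgRat_eq_bot_of_comm _ Φ₂
    (fun k ↦ (endAlgRat_ellipticPeriod_eq_bot_iff (hτ k)).2 (hEnd k)) hcomm

include hEnd hcomm in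
/-- **`P_{(∏_k E_{τ_k}) × Y} = P_{∏_k E_{τ_k}} · P_Y`** for non-CM `τ_k`. [cite: Gordon1997, §3 Theorem (second bullet) and its proof]
[cite: MoonenZarhin1999LowDim, §3 (3.1)] -/
theorem hodgePoincare_pi_ellipticPeriod_prod_eq_mul_of_forall_ellipticEnd_eq_bot :
    hodgePoincare (prodPeriod (piPeriod fun k ↦ ellipticPeriod (hτ k)) Φ₂) =
      hodgePoincare (piPeriod fun k ↦ ellipticPeriod (hτ k)) * hodgePoincare Φ₂ :=
  hodgePoincare_pi_prod_eq_mul_of_forall_endAlgRat_eq_bot_of_comm _ Φ₂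
    (fun k ↦ (endAlgRat_ellipticPeriod_eq_bot_iff (hτ k)).2 (hEnd k)) hcomm

include hEnd hcomm in
/-- **`D = B` on `Y` ⟹ `D = B` on `E_{τ_1} × ⋯ × E_{τ_K} × Y`** (all codimensions), non-CM `τ_k` arbitrary.
[cite: MoonenZarhin1999LowDim, §3 Theorem (2) and (3.1)] [cite: Gordon1997, §3 Theorem (second bullet)] -/
theorem divisorClasses_pi_ellipticPeriod_prod_eq_hodgeClasses_of_forall_ellipticEnd_eq_bot
    (hY : ∀ b, divisorClasses Φ₂ b = hodgeClasses Φ₂ b) (p : ℕ) :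
    divisorClasses (prodPeriod (piPeriod fun k ↦ ellipticPeriod (hτ k)) Φ₂) p =
      hodgeClasses (prodPeriod (piPeriod fun k ↦ ellipticPeriod (hτ k)) Φ₂) p :=
  forall_divisorClasses_pi_prod_eq_hodgeClasses_of_forall_endAlgRat_eq_bot_of_comm _ Φ₂
    (fun k ↦ (endAlgRat_ellipticPeriod_eq_bot_iff (hτ k)).2 (hEnd k)) hcomm hY p

include hEnd hcomm in
/-- **`Hg(E_{τ_1} × ⋯ × E_{τ_K} × Y) = Lf(·, η) ⟺ Hg(Y) = Lf(Y, η₂)`** (all polarisations), non-CM `τ_k` arbitrary.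
[cite: MoonenZarhin1999LowDim, §3 Theorem (2) with §1 (condition (D)) and §3 Corollary] [cite: Gordon1997, 2.15 Lemma and 7.5 Theorem (b)] -/
theorem IsRiemannForm.hodgeGroup_pi_ellipticPeriod_prod_eq_lefschetzGroup_iff_of_forall_ellipticEnd_eq_bot
    [FiniteDimensional ℂ E₂] {ω₂ : E₂ [⋀^Fin 2]→L[ℝ] ℝ} (h₂ : IsRiemannForm Φ₂ ω₂)
    {η : ((Fin K → ℂ) × E₂) [⋀^Fin 2]→L[ℝ] ℝ} (hη : IsRiemannForm (prodPeriod (piPeriod fun k ↦ ellipticPeriod (hτ k)) Φ₂) η)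
    {η₂ : E₂ [⋀^Fin 2]→L[ℝ] ℝ} (hη₂ : IsRiemannForm Φ₂ η₂) :
    hodgeGroup (prodPeriod (piPeriod fun k ↦ ellipticPeriod (hτ k)) Φ₂) =
        lefschetzGroup (prodPeriod (piPeriod fun k ↦ ellipticPeriod (hτ k)) Φ₂) η ↔
      hodgeGroup Φ₂ = lefschetzGroup Φ₂ η₂ :=
  IsRiemannForm.hodgeGroup_pi_prod_eq_lefschetzGroup_iff_of_forall_endAlgRat_eq_bot_of_comm _ Φ₂
    (fun k ↦ (endAlgRat_ellipticPeriod_eq_bot_iff (hτ k)).2 (hEnd k)) hcomm h₂ hη hη₂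

end Elliptic

section Locus

variable {K : ℕ} (X : Fin K → ((Fin 2 → ℝ) ≃L[ℝ] ℂ))
  {κ : Type*} [Fintype κ] [DecidableEq κ] {σ : κ → Type*} [∀ l, Fintype (σ l)] [∀ l, DecidableEq (σ l)]
  {F : κ → Type*} [∀ l, NormedAddCommGroup (F l)] [∀ l, NormedSpace ℂ (F l)] [∀ l, FiniteDimensional ℂ (F l)]
  (Ψ : ∀ l, (σ l → ℝ) ≃L[ℝ] F l) (hX : ∀ k, endAlgRat (X k) = ⊥)

omit [∀ l, FiniteDimensional ℂ (F l)] in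
include hX in
/-- **`Hg(X₁ × ⋯ × X_K × ∏ₗ Z_l) = Hg(X₁ × ⋯ × X_K) × Hg(∏ₗ Z_l)`** for ANY non-CM one-dimensional `X_k` and any finite
family of tori `Z_l` on the Hodge-circle locus (g35-#2: `Hg(∏ₗ Z_l)(ℂ)` is commutative).
[cite: MoonenZarhin1999LowDim, §3 Theorem (2), (0.2)(4) and §3 Corollary] [cite: Imai1976HodgeGroups, §2 Proposition, third case, and §3 Remarks] -/
theorem hodgeGroup_pi_prod_sigmaPiPeriod_eq_map_prod_of_forall_endAlgRat_eq_bot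
    (h : ∀ l, (hodgeGroup (Ψ l) : Set (SpecialLinearGroup (σ l) ℝ)) = Set.range (hodgeCircleSL (Ψ l))) :
    hodgeGroup (prodPeriod (piPeriod X) (sigmaPiPeriod Ψ)) =
      ((hodgeGroup (piPeriod X)).prod (hodgeGroup (sigmaPiPeriod Ψ))).map (blockDiag (Fin K × Fin 2) (Σ l, σ l)) :=
  hodgeGroup_pi_prod_eq_map_prod_of_forall_endAlgRat_eq_bot_of_comm X (sigmaPiPeriod Ψ) hX
    fun _ _ hM hN ↦ congrArg Subtype.val (hodgeGroupC_sigmaPiPeriod_comm_of_coe_eq_range Ψ h hM hN)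

include hX in
/-- **HODGE = LEFSCHETZ FOR `X₁ × ⋯ × X_K × ∏ₗ Z_l`, UNCONDITIONALLY, FOR EVERY POLARISATION** — ANY one-dimensional tori
`X_k` without complex multiplication times ANY finite family of positive-dimensional tori on the Hodge-circle locus
(these include every CM elliptic curve and every product of such): "every product of elliptic curves satisfies
condition (D)", group half, with CM blocks of any dimension. [cite: MoonenZarhin1999LowDim, §3 Corollary (p0007 L80–L85) and §3 Theorem (2)]
[cite: Gordon1997, 7.5 Theorem (b) and §3 Theorem] [cite: Lange2023AbelianVarietiesComplex, §7.2.4 Exercises (4), (5)] -/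
theorem IsRiemannForm.hodgeGroup_pi_prod_sigmaPiPeriod_eq_lefschetzGroup_of_forall_endAlgRat_eq_bot
    (hg : ∀ l, 0 < finrank ℂ (F l))
    (h : ∀ l, (hodgeGroup (Ψ l) : Set (SpecialLinearGroup (σ l) ℝ)) = Set.range (hodgeCircleSL (Ψ l)))
    {η : ((Fin K → ℂ) × ∀ l, F l) [⋀^Fin 2]→L[ℝ] ℝ} (hη : IsRiemannForm (prodPeriod (piPeriod X) (sigmaPiPeriod Ψ)) η) :
    hodgeGroup (prodPeriod (piPeriod X) (sigmaPiPeriod Ψ)) = lefschetzGroup (prodPeriod (piPeriod X) (sigmaPiPeriod Ψ)) η := by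
  obtain ⟨ω₂, h₂⟩ := isAbelianVariety_sigmaPiPeriod_of_coe_eq_range Ψ hg h
  exact IsRiemannForm.hodgeGroup_pi_prod_eq_lefschetzGroup_of_forall_endAlgRat_eq_bot_of_comm X (sigmaPiPeriod Ψ) hX
    (fun _ _ hM hN ↦ congrArg Subtype.val (hodgeGroupC_sigmaPiPeriod_comm_of_coe_eq_range Ψ h hM hN)) h₂
    (h₂.lefschetzGroup_sigmaPiPeriod_eq_hodgeGroup_of_coe_eq_range Ψ hg h).symm hη

include hX in
/-- **`D = B` ON `X₁ × ⋯ × X_K × ∏ₗ Z_l` IN EVERY CODIMENSION, UNCONDITIONALLY** (g33/g35: `D = B` on `∏ₗ Z_l`).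
[cite: MoonenZarhin1999LowDim, §3 Theorem (2), (3.1) and §3 Corollary] [cite: Gordon1997, §3 Theorem (second bullet)] -/
theorem divisorClasses_pi_prod_sigmaPiPeriod_eq_hodgeClasses_of_forall_endAlgRat_eq_bot (hg : ∀ l, 0 < finrank ℂ (F l))
    (h : ∀ l, (hodgeGroup (Ψ l) : Set (SpecialLinearGroup (σ l) ℝ)) = Set.range (hodgeCircleSL (Ψ l))) (p : ℕ) :
    divisorClasses (prodPeriod (piPeriod X) (sigmaPiPeriod Ψ)) p =
      hodgeClasses (prodPeriod (piPeriod X) (sigmaPiPeriod Ψ)) p :=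
  forall_divisorClasses_pi_prod_eq_hodgeClasses_of_forall_endAlgRat_eq_bot_of_comm X (sigmaPiPeriod Ψ) hX
    (fun _ _ hM hN ↦ congrArg Subtype.val (hodgeGroupC_sigmaPiPeriod_comm_of_coe_eq_range Ψ h hM hN))
    (fun b ↦ divisorClasses_sigmaPiPeriod_eq_hodgeClasses_of_coe_eq_range Ψ hg h b) p

omit [∀ l, FiniteDimensional ℂ (F l)] in
include hX in
/-- **`P_{X₁ × ⋯ × X_K × ∏ₗ Z_l} = P_{∏_k X_k} · P_{∏ₗ Z_l}`** on the locus. [cite: Gordon1997, §3 Theorem (second bullet) and its proof]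
[cite: MoonenZarhin1999LowDim, §3 Theorem (2) and (3.1)] -/
theorem hodgePoincare_pi_prod_sigmaPiPeriod_eq_mul_of_forall_endAlgRat_eq_bot
    (h : ∀ l, (hodgeGroup (Ψ l) : Set (SpecialLinearGroup (σ l) ℝ)) = Set.range (hodgeCircleSL (Ψ l))) :
    hodgePoincare (prodPeriod (piPeriod X) (sigmaPiPeriod Ψ)) =
      hodgePoincare (piPeriod X) * hodgePoincare (sigmaPiPeriod Ψ) :=
  hodgePoincare_pi_prod_eq_mul_of_forall_endAlgRat_eq_bot_of_comm X (sigmaPiPeriod Ψ) hX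
    fun _ _ hM hN ↦ congrArg Subtype.val (hodgeGroupC_sigmaPiPeriod_comm_of_coe_eq_range Ψ h hM hN)

end Locus

end ComplexTorus

end Literature.Geometry.Kaehler

end
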